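import Mathlib
import HarnessLib
import Summits.RiemannHypothesis.RiemannHypothesis.Theses.NbSectionTwoDyadic

/-!
# RiemannHypothesis / NbSectionTwoDyadic — the zero-free DUAL CERTIFICATE of the dyadic law

Route `NbSectionTwoDyadic` (exact dyadic law of the 2-section of the truncated Nyman–Beurling
distance), crux `DyadicDualCertificate` (item stmt-RiemannHypothesis-22781).

With `D = 18·2^K − 8`, weights `w_k = 1/(k(k+1))`, block residual `r_k = 4(−2)^⌊log₂ k⌋ / D`
(`1 ≤ k < 2^(K+1)`) and tail `r_tail = (−1)^(K+1) 2^(K+1) / D` (tail mass `1/2^(K+1)`):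

* orthogonality to EVERY generator `1 ≤ j ≤ 2^K` (dyadic or not):
  `Σ_{j ≤ k < 2^(K+1)} w_k r_k min(2, ⌊k/j⌋) + r_tail / 2^K = 0`;
* `⟨1, r⟩ = Σ w_k r_k + r_tail / 2^(K+1) = 1/D`;
* `‖r‖² = Σ w_k r_k² + r_tail² / 2^(K+1) = 1/D`.

Proof. Everything reduces to the PREFIX SUMS `P(a) = Σ_{1 ≤ k < a} w_k (−2)^⌊log₂ k⌋`, which have the
closed form `P(a) = (1 + 3(−1)^i)/4 − (−2)^i / a`, `i = ⌊log₂ a⌋` (induction on `a`: the weight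
telescopes, `w_k = 1/k − 1/(k+1)`, and `⌊log₂(a+1)⌋` is `i` or `i + 1` according as `a + 1 < 2^(i+1)`
or `a + 1 = 2^(i+1)`), and `Q(a) = Σ_{1 ≤ k < a} w_k 4^⌊log₂ k⌋ = (3·2^i − 1)/2 − 4^i / a`.  For the
orthogonality, `min(2, ⌊k/j⌋)` is `1` on `j ≤ k < 2j` and `2` on `k ≥ 2j`, so the pairing is
`(4/D)(P(2j) − P(j)) + (8/D)(P(2^(K+1)) − P(2j))`, and `P(j) + P(2j) = 1/2`,
`P(2^(K+1)) = (1 + (−1)^K)/4` finish it against the tail `2(−1)^(K+1)/D`.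

Elementary finite sums (weak-duality certificate, no zeros of anything); RH-free. No summit is
proved by this file; nothing here bears on the truth of RH.
-/

noncomputable section

-- D-0017: `Summit.<S>.<S>.…` is the designed namespace of a single-problem summit.
set_option linter.dupNamespace false

namespace Summit.RiemannHypothesis.RiemannHypothesis.Theorems.NbSectionTwo

open Finset

/-- `((−2)^n)² = (2^n)²`. -/
theorem neg_two_pow_sq (n : ℕ) : ((-2 : ℝ) ^ n) ^ 2 = ((2 : ℝ) ^ n) ^ 2 := by
  rw [← pow_mul, ← pow_mul, mul_comm, pow_mul, pow_mul]; norm_num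

/-- The weight telescopes: `1/(k(k+1)) = 1/k − 1/(k+1)` (`k ≠ 0`). -/
theorem weight_eq_one_div_sub (k : ℕ) (hk : k ≠ 0) :
    1 / ((k : ℝ) * (k + 1)) = 1 / k - 1 / (k + 1) := by
  have hk' : (k : ℝ) ≠ 0 := by exact_mod_cast hk
  have hk1 : (k : ℝ) + 1 ≠ 0 := by positivity
  rw [div_sub_div _ _ hk' hk1, one_mul, mul_one, add_sub_cancel_left]

/-- The dichotomy for `⌊log₂ (a+1)⌋` (`a ≠ 0`): it equals `⌊log₂ a⌋` when `a + 1 < 2^(⌊log₂ a⌋+1)`,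
and `⌊log₂ a⌋ + 1` when `a + 1 = 2^(⌊log₂ a⌋+1)`. -/
theorem log_two_succ_cases (a : ℕ) (ha : a ≠ 0) :
    (Nat.log 2 (a + 1) = Nat.log 2 a ∧ a + 1 < 2 ^ (Nat.log 2 a + 1)) ∨
    (Nat.log 2 (a + 1) = Nat.log 2 a + 1 ∧ a + 1 = 2 ^ (Nat.log 2 a + 1)) := by
  have h1 : 2 ^ Nat.log 2 a ≤ a := Nat.pow_log_le_self 2 ha
  have h2 : a < 2 ^ (Nat.log 2 a + 1) := Nat.lt_pow_succ_log_self (by norm_num) a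
  rcases Nat.lt_or_ge (a + 1) (2 ^ (Nat.log 2 a + 1)) with hlt | hge
  · exact Or.inl ⟨Nat.log_eq_of_pow_le_of_lt_pow (by omega) hlt, hlt⟩
  · have heq : a + 1 = 2 ^ (Nat.log 2 a + 1) := by omega
    exact Or.inr ⟨by rw [heq]; exact Nat.log_pow (by norm_num) _, heq⟩

/-- A block sum is a difference of two prefix sums (`1 ≤ a ≤ b`). -/
theorem sum_Ico_eq_prefix_sub (f : ℕ → ℝ) {a b : ℕ} (ha : 1 ≤ a) (hab : a ≤ b) :
    ∑ k ∈ Finset.Ico a b, f k = ∑ k ∈ Finset.Ico 1 b, f k - ∑ k ∈ Finset.Ico 1 a, f k :=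
  eq_sub_of_add_eq' (Finset.sum_Ico_consecutive f ha hab)

/-- **Prefix sums of the certificate**: for `a ≥ 1`, with `i = ⌊log₂ a⌋`,
`Σ_{1 ≤ k < a} (−2)^⌊log₂ k⌋ / (k(k+1)) = (1 + 3(−1)^i)/4 − (−2)^i / a`. -/
theorem prefix_weight_sum (a : ℕ) (ha : 1 ≤ a) :
    ∑ k ∈ Finset.Ico (1 : ℕ) a, 1 / ((k : ℝ) * (k + 1)) * (-2 : ℝ) ^ Nat.log 2 k
      = (1 + 3 * (-1 : ℝ) ^ Nat.log 2 a) / 4 - (-2 : ℝ) ^ Nat.log 2 a / a := by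
  induction a, ha using Nat.le_induction with
  | base => norm_num
  | succ a ha ih =>
    rw [Finset.sum_Ico_succ_top ha, ih, weight_eq_one_div_sub a (by omega)]
    have ha' : (a : ℝ) ≠ 0 := by exact_mod_cast (show a ≠ 0 by omega)
    rcases log_two_succ_cases a (by omega) with ⟨hlog, -⟩ | ⟨hlog, heq⟩
    · rw [hlog]
      push_cast
      field_simp
      ring
    · have hcast : ((a + 1 : ℕ) : ℝ) = 2 ^ (Nat.log 2 a + 1) := by exact_mod_cast heq
      have hcast' : (a : ℝ) + 1 = 2 ^ (Nat.log 2 a + 1) := by push_cast at hcast; exact hcast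
      have h2 : ∀ n : ℕ, (-2 : ℝ) ^ n = (-1) ^ n * 2 ^ n := fun n => by
        rw [← mul_pow]; norm_num
      rw [hlog, hcast, hcast']
      simp only [h2]
      field_simp
      ring

/-- The full dyadic range: `Σ_{1 ≤ k < 2^n} (−2)^⌊log₂ k⌋ / (k(k+1)) = (1 − (−1)^n)/4`. -/
theorem prefix_weight_sum_two_pow (n : ℕ) :
    ∑ k ∈ Finset.Ico (1 : ℕ) (2 ^ n), 1 / ((k : ℝ) * (k + 1)) * (-2 : ℝ) ^ Nat.log 2 k
      = (1 - (-1 : ℝ) ^ n) / 4 := by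
  rw [prefix_weight_sum (2 ^ n) Nat.one_le_two_pow, Nat.log_pow (by norm_num)]
  push_cast
  rw [show (-2 : ℝ) ^ n = (-1) ^ n * 2 ^ n by rw [← mul_pow]; norm_num, mul_div_assoc,
    div_self (by positivity), mul_one]
  ring

/-- **Prefix sums of the squared certificate**: for `a ≥ 1`, with `i = ⌊log₂ a⌋`,
`Σ_{1 ≤ k < a} 4^⌊log₂ k⌋ / (k(k+1)) = (3·2^i − 1)/2 − 4^i / a`. -/
theorem prefix_weight_sq_sum (a : ℕ) (ha : 1 ≤ a) :
    ∑ k ∈ Finset.Ico (1 : ℕ) a, 1 / ((k : ℝ) * (k + 1)) * ((-2 : ℝ) ^ Nat.log 2 k) ^ 2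
      = (3 * (2 : ℝ) ^ Nat.log 2 a - 1) / 2 - ((2 : ℝ) ^ Nat.log 2 a) ^ 2 / a := by
  induction a, ha using Nat.le_induction with
  | base => norm_num
  | succ a ha ih =>
    rw [Finset.sum_Ico_succ_top ha, ih, weight_eq_one_div_sub a (by omega), neg_two_pow_sq]
    have ha' : (a : ℝ) ≠ 0 := by exact_mod_cast (show a ≠ 0 by omega)
    rcases log_two_succ_cases a (by omega) with ⟨hlog, -⟩ | ⟨hlog, heq⟩
    · rw [hlog]
      push_cast
      field_simp
      ring
    · have hcast : ((a + 1 : ℕ) : ℝ) = 2 ^ (Nat.log 2 a + 1) := by exact_mod_cast heq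
      have hcast' : (a : ℝ) + 1 = 2 ^ (Nat.log 2 a + 1) := by push_cast at hcast; exact hcast
      rw [hlog, hcast, hcast']
      field_simp
      ring

/-- The full dyadic range: `Σ_{1 ≤ k < 2^n} 4^⌊log₂ k⌋ / (k(k+1)) = (2^n − 1)/2`. -/
theorem prefix_weight_sq_sum_two_pow (n : ℕ) :
    ∑ k ∈ Finset.Ico (1 : ℕ) (2 ^ n), 1 / ((k : ℝ) * (k + 1)) * ((-2 : ℝ) ^ Nat.log 2 k) ^ 2
      = ((2 : ℝ) ^ n - 1) / 2 := by
  rw [prefix_weight_sq_sum (2 ^ n) Nat.one_le_two_pow, Nat.log_pow (by norm_num)]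
  push_cast
  field_simp
  ring

/-- **Crux `DyadicDualCertificate`** (item stmt-RiemannHypothesis-22781) of route
`NbSectionTwoDyadic`: the dyadic block residual is a zero-free dual certificate — orthogonal to all
`2^K` generators `min(2, ⌊k/j⌋)` (`1 ≤ j ≤ 2^K`) in the weights `1/(k(k+1))` with tail mass
`1/2^(K+1)`, with `⟨1, r⟩ = ‖r‖² = 1/(18·2^K − 8)`. RH-free; no summit is proved by this. -/
theorem DyadicDualCertificate_proof :
    Summit.RiemannHypothesis.RiemannHypothesis.Theses.NbSectionTwoDyadic.DyadicDualCertificate := by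
  unfold Summit.RiemannHypothesis.RiemannHypothesis.Theses.NbSectionTwoDyadic.DyadicDualCertificate
  intro K
  have hDpos : (0 : ℝ) < 18 * 2 ^ K - 8 := by
    have h1 : (1 : ℝ) ≤ 2 ^ K := one_le_pow₀ (by norm_num)
    linarith
  generalize hDdef : (18 * 2 ^ K - 8 : ℝ) = D at hDpos
  have hD : D ≠ 0 := hDpos.ne'
  refine ⟨fun j hj hjK => ?_, ?_, ?_⟩
  · -- orthogonality to the generator `j`
    have hj0 : j ≠ 0 := by omega
    have hj' : (j : ℝ) ≠ 0 := by exact_mod_cast hj0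
    have h2j : 2 * j ≤ 2 ^ (K + 1) := by rw [pow_succ']; omega
    rw [← Finset.sum_Ico_consecutive _ (by omega : j ≤ 2 * j) h2j]
    have hA : ∑ k ∈ Finset.Ico j (2 * j), 1 / ((k : ℝ) * (k + 1)) *
          (4 * (-2 : ℝ) ^ Nat.log 2 k / D) * ((min 2 (k / j) : ℕ) : ℝ)
        = 4 / D * ∑ k ∈ Finset.Ico j (2 * j), 1 / ((k : ℝ) * (k + 1)) * (-2 : ℝ) ^ Nat.log 2 k := by
      rw [Finset.mul_sum]
      refine Finset.sum_congr rfl fun k hk => ?_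
      rw [Finset.mem_Ico] at hk
      have hdiv : k / j = 1 := Nat.div_eq_of_lt_le (by omega) (by omega)
      have hmin : min 2 (k / j) = 1 := by rw [hdiv]; decide
      rw [hmin]
      push_cast
      ring
    have hB : ∑ k ∈ Finset.Ico (2 * j) (2 ^ (K + 1)), 1 / ((k : ℝ) * (k + 1)) *
          (4 * (-2 : ℝ) ^ Nat.log 2 k / D) * ((min 2 (k / j) : ℕ) : ℝ)
        = 8 / D * ∑ k ∈ Finset.Ico (2 * j) (2 ^ (K + 1)),
            1 / ((k : ℝ) * (k + 1)) * (-2 : ℝ) ^ Nat.log 2 k := by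
      rw [Finset.mul_sum]
      refine Finset.sum_congr rfl fun k hk => ?_
      rw [Finset.mem_Ico] at hk
      have hdiv : 2 ≤ k / j := (Nat.le_div_iff_mul_le (by omega)).2 (by omega)
      rw [min_eq_left hdiv]
      push_cast
      ring
    rw [hA, hB, sum_Ico_eq_prefix_sub _ hj (by omega : j ≤ 2 * j),
      sum_Ico_eq_prefix_sub _ (by omega : 1 ≤ 2 * j) h2j,
      prefix_weight_sum_two_pow (K + 1), prefix_weight_sum j hj,
      prefix_weight_sum (2 * j) (by omega),
      show Nat.log 2 (2 * j) = Nat.log 2 j + 1 by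
        rw [mul_comm]; exact Nat.log_mul_base (by norm_num) hj0]
    push_cast
    field_simp
    ring
  · -- ⟨1, r⟩ = 1/D
    have hA : ∑ k ∈ Finset.Ico (1 : ℕ) (2 ^ (K + 1)), 1 / ((k : ℝ) * (k + 1)) *
          (4 * (-2 : ℝ) ^ Nat.log 2 k / D)
        = 4 / D * ∑ k ∈ Finset.Ico (1 : ℕ) (2 ^ (K + 1)), 1 / ((k : ℝ) * (k + 1)) * (-2 : ℝ) ^ Nat.log 2 k := by
      rw [Finset.mul_sum]
      exact Finset.sum_congr rfl fun k _ => by ring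
    rw [hA, prefix_weight_sum_two_pow (K + 1)]
    field_simp
    ring
  · -- ‖r‖² = 1/D
    have hA : ∑ k ∈ Finset.Ico (1 : ℕ) (2 ^ (K + 1)), 1 / ((k : ℝ) * (k + 1)) *
          (4 * (-2 : ℝ) ^ Nat.log 2 k / D) ^ 2
        = 16 / D ^ 2 * ∑ k ∈ Finset.Ico (1 : ℕ) (2 ^ (K + 1)),
            1 / ((k : ℝ) * (k + 1)) * ((-2 : ℝ) ^ Nat.log 2 k) ^ 2 := by
      rw [Finset.mul_sum]
      exact Finset.sum_congr rfl fun k _ => by ring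
    have hs : ((-1 : ℝ) ^ (K + 1)) ^ 2 = 1 := by
      rw [← pow_mul, mul_comm, pow_mul]; norm_num
    rw [hA, prefix_weight_sq_sum_two_pow (K + 1),
      show (1 : ℝ) / D = (18 * 2 ^ K - 8) / D ^ 2 by rw [hDdef, pow_two, ← div_div, div_self hD],
      div_pow, mul_pow, hs, one_mul]
    field_simp
    ring

end Summit.RiemannHypothesis.RiemannHypothesis.Theorems.NbSectionTwo

end
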